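import Literature.NumberTheory.EllipticCurves.Kato2004.IwasawaCohomology
import Literature.NumberTheory.EllipticCurves.GeomPointsGaloisModule
import HarnessLib

/-!
# Kato 2004 (Astérisque 295) §13.8: the reduction `𝐇¹_Γ(T_pW) → lim←_n H¹(ℚ_n, W[p])` modulo `p`
# and "`𝐇¹(T)/p𝐇¹(T) ⊂ 𝐇¹(T/p)`" as a named fact on the pinned datum `Kato2004.IwasawaH1Data`

Topic `NumberTheory/EllipticCurves`, sub-directory `Kato2004` (namespace = path).  Cell `bsd-smallim`
(rung K6 of `BirchSwinnertonDyer`, class X9, crux `MuTransferX9` = item 19276), seat `bsd-smallim-k6-ty`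
(typer): items S0.4 ("`red : 𝐇¹_Γ(T_pW) → 𝐇¹_Ω`") and S0.5 ("`ker red = p·𝐇¹`") of the CORE-PLAN
(HOME `plan/k6/lines/MuTransferX9_CORE-PLAN_k6c2.md` §0) for the open stub `stub_coreX9` of the
registered skeleton v4 (`0154dd5daf38efd6`), in the CURRENCY OF THE PIN: `Kato2004.IwasawaH1Data W p κ γ`
(`IwasawaCohomology.lean`: `𝐇¹_Γ(T_pW) = lim←_n H¹(ℤ_n[1/p], T_pW)` along the layers `ℚ_n` of `κ`,
levelwise `proj n : I.H → H¹(ℚ_n, T_pW)`, with `integralH1`, `layerCores`, `normCompatible` GENERIC in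
the coefficient representation).  Everything is a DEFINITION with body or a PROVED lemma, except ONE
named fact (`def … : Prop`, D-0014; nothing asserted, no `_holds` here): Kato's inclusion
`𝐇¹(T)/p𝐇¹(T) ⊂ H¹(ℤ[1/p], T ⊗ Λ/pΛ)` read on the pin.

## Contents

* §1 (namespace `Literature.NumberTheory.GaloisRepresentations`, generic): functoriality of
  `H¹_cont` on explicit cocycles along an ADDITIVE continuous equivariant map `f : X → Y` between
  topological representations of the same group with POSSIBLY DIFFERENT coefficient rings
  (`X : TopRep R G`, `Y : TopRep R' G` — here `R = ℤ_p` for `T_pW` and `R' = ℤ` for the discrete module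
  `W[p]`; Mathlib's `ContinuousCohomology.map` needs one ring): `liftH1AddHom` (additive maps out of
  `H¹` defined on cocycles, the `AddMonoidHom` twin of the tree's `liftH1ₗ`), `contOneCocycles.pushAddHom`,
  `mapH1AddHom` with `mapH1AddHom_oneCocycleClass` (`[φ] ↦ [f ∘ φ]`), and its compatibility with the
  tree's restriction `resLe`, relative corestriction `coresLe` (explicit transfer,
  `coresLe_oneCocycleClass`) and conjugation action `conjMap` — all three PROVED on cocycles.
* §2 (namespace `Literature.NumberTheory.EllipticCurves.Kato2004`): the reduction `T_pW → W[p]`,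
  `a ↦ a mod p` (`tateModP`, first component `TateModule.proj p 1`; continuous, `Γ_ℚ`-equivariant), the
  levelwise reduction `reduceH1 W p U : H¹(U, T_pW) →+ H¹(U, W[p])` for every `U ≤ Γ_ℚ` and its
  compatibilities `reduceH1_resLe`, `reduceH1_coresLe`, `reduceH1_layerCores`, `reduceH1_conjMap`,
  `reduceH1_mem_integralH1` (integral classes reduce to integral classes).
* §3 (S0.4) on the pin `I : IwasawaH1Data W p κ γ`: `I.red : I.H →+ ∏_n H¹(ℚ_n, W[p])`,
  `x ↦ (reduceH1 (proj n x))_n`, with values in `Kato2004.normCompatible (W.torsionGaloisModule p) κ`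
  (`red_mem_normCompatible`: norm-compatible and integral), `red_X_smul` (`T ↦ conj_γ − 1`) and
  `red_eq_zero_of_mem` (`p·𝐇¹ ⊆ ker red`, the classes of `W[p]` being killed by `p`).
* §4 (S0.5) the named fact `mem_pSmul_of_red_eq_zero` = Kato §13.8 "`𝐇¹(T)/p𝐇¹(T) ⊂
  H¹(ℤ[1/p], T ⊗ Λ/pΛ)`" read on the pin (`ker red ⊆ p·𝐇¹`), and its consumer shapes
  `mem_pSmul_of_red_eq_zero.red_eq_zero_iff` (`ker red = p·I.H`) and `.exists_red_ne_zero`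
  (`s ∉ p𝐇¹ ⟹ red_n s ≠ 0` for some `n` — the form in which `stub_coreX9`'s hypothesis
  `s ∉ (augIdealP p) • ⊤` is consumed).

The Shapiro transport of `red` into k6-c2's `twistTower (W.torsionGaloisModule p) κ`
(`IwasawaTwistModPTower.lean`, `lim←_J H¹(ℚ, 𝒯_J)`) is NOT done here: it needs the compatibility of
the Shapiro isomorphism `twistModPH1Equiv` (`IwasawaTwistModPShapiro.lean`) with `layerCores` /
`twistModPTruncate`, a separate statement.

## The printed statements (K. Kato, Astérisque 295 (2004); `[p. N]` = printed page; store key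
`paper:doi-10-24033-ast-639`, PDF page `N − 115`)

* **§12.2 [p. 220]** "Let `T` be a finitely generated `ℤ_p`-module endowed with a continuous action of
  `Gal(ℚ̄/ℚ)` which is unramified at almost all prime numbers. We denote `𝐇^q(T) = lim←_n
  H^q(ℤ[ζ_{p^n}, 1/p], T)` where `H^q` is the etale cohomology as in 8.2, and the inverse limit is
  taken with respect to trace maps."  (Applies to `T` AND to the finite module `T/p`.)
* **§13.8, proof of Thm. 12.4 (2) [p. 228]** "Let `x` be a non-zero-divisor of `Λ`. We prove that
  `x : 𝐇¹(T) → 𝐇¹(T)` is injective. … First consider the case `x = p`. By the exact sequence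
  `0 → [lim←_n H⁰(ℚ(ζ_{p^n}), T/p) modulo the image of H⁰(·, T)] → 𝐇¹(T) →p 𝐇¹(T)` the injectivity
  of `p : 𝐇¹(T) → 𝐇¹(T)` is reduced to `lim←_n H⁰(ℚ(ζ_{p^n}), T/p) = 0`. … For `n ≥ 0`,
  `H^q(ℤ[ζ_{p^n}, 1/p], T) ≅ H^q(ℤ[1/p], T ⊗_{O_λ} O_λ[G_n])` where `Gal(ℚ̄/ℚ)` acts on the tensor
  product … by `σ ⊗ σ_n⁻¹` … Hence `𝐇^q(T) = lim←_n H^q(ℤ[1/p], T ⊗_{O_λ} O_λ[G_n])`. Hence we have an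
  exact sequence `H⁰(ℚ, T ⊗_{O_λ} Λ/xΛ) → 𝐇¹(T) →x 𝐇¹(T)`."
* **§13.8, proof of Thm. 12.4 (3) [p. 229]** "It is sufficient to prove that `x` and `y` form a
  regular sequence for `𝐇¹(T)` … By `𝐇¹(T)/x𝐇¹(T) ⊂ H¹(ℤ[1/p], T ⊗_{O_λ} Λ/xΛ)` and by the exact
  sequence `0 → j_*(T ⊗_{O_λ} Λ/xΛ) →y j_*(T ⊗_{O_λ} Λ/xΛ) → j_*(T ⊗_{O_λ} Λ/(x, y))`, it is sufficient
  to prove `H⁰(ℤ[1/p], T ⊗_{O_λ} Λ/(x, y)) = 0`."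
* **Lemma 8.5 (1) [p. 183]** ([Pe0, 2.2.4], [Ru4, B3.3]) "For any set `S` of finite places of `K`
  containing all places lying over `p`, the canonical map `H¹(O_K[S⁻¹], T) → H¹(K, T)` is injective."
  **(2)** "The image of `lim←_n H¹(K(ζ_{p^n}), T) → H¹(K, T)` is contained in the image of
  `H¹(O_K[1/p], T) → H¹(K, T)`."

READING (the fact `mem_pSmul_of_red_eq_zero`, steps (r1)–(r4)): (r1) take `x = p` in "𝐇¹(T)/x𝐇¹(T) ⊂
H¹(ℤ[1/p], T ⊗ Λ/xΛ)" (pure homological algebra from `0 → T ⊗ Λ →p T ⊗ Λ → T/p ⊗ Λ → 0` and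
`𝐇¹(T) = H¹(ℤ[1/p], T ⊗ Λ)`, p. 228; no non-CM / `p ≠ 2` hypothesis enters); (r2) `H¹(ℤ[1/p], T ⊗ Λ/pΛ)
= lim←_n H¹(ℤ[1/p], T/p ⊗ 𝔽_p[G_n]) ≅ lim←_n H¹(ℤ[ζ_{p^n}, 1/p], T/p)` (the displayed Shapiro identity
for the module `T/p`, allowed by §12.2) `↪ ∏_n H¹(ℚ(ζ_{p^n}), T/p)` (Lemma 8.5 (1) for `T/p`,
`S = {v ∣ p}`); (r3) the composite `𝐇¹(T) → ∏_n H¹(ℚ(ζ_{p^n}), T/p)` is, levelwise, the change of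
coefficients `T → T/p` (naturality of the Shapiro identity and of §8.2's `H^q(R, T) = lim←_k
H^q(R, T/p^k)` in `T`), i.e. this file's `reduceH1`; (r4) the pin is the `Δ`-trivial component of
`𝐇¹(T_pW)` written along the layers `ℚ_n ⊂ ℚ(ζ_{p^{n+1}})` of `κ` (module docstring READING of
`IwasawaCohomology.lean`, the reading under which `nonempty_iwasawaH1Data` / `thm12_4` are stated):
vanishing of the reduction in `H¹(ℚ_n, W[p])` gives vanishing in `H¹(ℚ(ζ_{p^{n+1}}), W[p])` by
restriction, and `p𝐇¹ ∩ 𝐇¹_j = p𝐇¹_j` for the direct summand `𝐇¹_j` ((12.1.2)).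

## References

* K. Kato, *p-adic Hodge theory and values of zeta functions of modular forms*, Astérisque 295
  (2004), 117–290: §8.2, Lemma 8.5, §12.2, §13.8 (pp. 228–229). [Kato2004Asterisque]
* K. Rubin, *Euler Systems*, Ann. of Math. Studies 147 (2000), App. B §2–§3 (Prop. B.2.3, B.3.3).
  [Rubin2000]
* J.-P. Serre, *Galois Cohomology* (1997), I §2.2–2.5. [SerreGaloisCohomology1997]
* HOME/koly/MU-TRANSFER-PROOF.md §2 Step 0; HOME plan/k6/lines/MuTransferX9_CORE-PLAN_k6c2.md S0.4/S0.5.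
-/

noncomputable section

open scoped NumberField
open Field IsDedekindDomain CategoryTheory
open Literature.NumberTheory.GaloisRepresentations
open Literature.NumberTheory.EllipticCurves Literature.NumberTheory.EllipticCurves.Kato2004
open Literature.NumberTheory.EllipticCurves.Kato2004.EulerSystemValues
open WeierstrassCurve (geomPoints geomTorsion)

universe u u' v

/-! ## §1 Functoriality of `H¹_cont` along an additive equivariant map (two coefficient rings) -/

namespace Literature.NumberTheory.GaloisRepresentations

section AddHom

variable {R : Type u} [Ring R] [TopologicalSpace R] {R' : Type u'} [Ring R'] [TopologicalSpace R']
variable {G : Type v} [Group G] [TopologicalSpace G] [IsTopologicalGroup G]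

section Lift

variable (X : TopRep.{v} R G) {Z : Type*} [AddCommGroup Z]

/-- **Additive maps out of `H¹` defined on cocycles** (the `AddMonoidHom` twin of the tree's
`liftH1ₗ`): an additive map on continuous crossed homomorphisms killing those with trivial class
descends to `H¹_cont(G, X) = Z¹/B¹` (`oneCocycleClass` is onto, `oneCocycleClass_surjective`).
[cite: SerreGaloisCohomology1997, I §2.2] -/
def liftH1AddHom (φ : contOneCocycles X →+ Z) (hφ : ∀ f, oneCocycleClass X f = 0 → φ f = 0) :
    continuousCohomology 1 X →+ Z :=
  (QuotientAddGroup.lift (oneCocycleClassₗ X).toAddMonoidHom.ker φ fun f hf ↦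
      (AddMonoidHom.mem_ker).2 (hφ f (by simpa [oneCocycleClassₗ_apply] using hf))).comp
    (QuotientAddGroup.quotientKerEquivOfSurjective (oneCocycleClassₗ X).toAddMonoidHom
        (fun c ↦ oneCocycleClass_surjective X c)).symm.toAddMonoidHom

/-- `liftH1AddHom φ [f] = φ f` (`H¹ = Z¹/B¹` on continuous inhomogeneous cochains).
[cite: SerreGaloisCohomology1997, I §2.2] -/
@[simp]
theorem liftH1AddHom_oneCocycleClass (φ : contOneCocycles X →+ Z)
    (hφ : ∀ f, oneCocycleClass X f = 0 → φ f = 0) (f : contOneCocycles X) :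
    liftH1AddHom X φ hφ (oneCocycleClass X f) = φ f := by
  unfold liftH1AddHom
  have hsymm : (QuotientAddGroup.quotientKerEquivOfSurjective (oneCocycleClassₗ X).toAddMonoidHom
      (fun c ↦ oneCocycleClass_surjective X c)).symm (oneCocycleClass X f) =
        (QuotientAddGroup.mk f : _ ⧸ (oneCocycleClassₗ X).toAddMonoidHom.ker) := by
    rw [AddEquiv.symm_apply_eq]
    rfl
  rw [AddMonoidHom.coe_comp, Function.comp_apply, AddEquiv.coe_toAddMonoidHom, hsymm,
    QuotientAddGroup.lift_mk']

end Lift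

variable {X : TopRep.{v} R G} {Y : TopRep.{v} R' G}

/-- **Push-forward of continuous crossed homomorphisms** along an additive, continuous,
`G`-equivariant map `f : X → Y` (coefficient rings may differ): `φ ↦ f ∘ φ`.
[cite: SerreGaloisCohomology1997, I §2.2] -/
def contOneCocycles.pushAddHom (f : X →+ Y) (hf : Continuous f)
    (hρ : ∀ (g : G) (x : X), f (X.ρ g x) = Y.ρ g (f x)) :
    contOneCocycles X →+ contOneCocycles Y where
  toFun φ := ⟨(⟨f, hf⟩ : C(X, Y)).comp φ.1, fun g h ↦ by
    change f (φ.1 (g * h)) = f (φ.1 g) + Y.ρ g (f (φ.1 h))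
    rw [φ.2 g h, map_add, hρ]⟩
  map_zero' := Subtype.ext (ContinuousMap.ext fun g ↦ by
    change f ((0 : contOneCocycles X).1 g) = (0 : contOneCocycles Y).1 g
    simp)
  map_add' φ ψ := Subtype.ext (ContinuousMap.ext fun g ↦ by
    change f ((φ + ψ).1 g) = f (φ.1 g) + f (ψ.1 g)
    rw [Submodule.coe_add, ContinuousMap.add_apply, map_add])

omit [IsTopologicalGroup G] in
/-- Values of the push-forward: `(f_* φ)(g) = f (φ g)`. [cite: SerreGaloisCohomology1997, I §2.2] -/
@[simp]
theorem contOneCocycles.pushAddHom_apply (f : X →+ Y) (hf : Continuous f)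
    (hρ : ∀ (g : G) (x : X), f (X.ρ g x) = Y.ρ g (f x)) (φ : contOneCocycles X) (g : G) :
    (contOneCocycles.pushAddHom f hf hρ φ).1 g = f (φ.1 g) :=
  rfl

variable (X Y) in
/-- **Functoriality of `H¹_cont(G, –)` along an additive continuous `G`-equivariant map `f : X → Y`
between topological representations with possibly different coefficient rings**: `[φ] ↦ [f ∘ φ]`
(principal crossed homomorphisms go to principal ones).  For a morphism of `TopRep R G` this is the
map underlying Mathlib's `ContinuousCohomology.map (id_G) f 1` (same formula on cocycles,
`map_oneCocycleClass`).  [cite: SerreGaloisCohomology1997, I §2.2] -/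
def mapH1AddHom (f : X →+ Y) (hf : Continuous f)
    (hρ : ∀ (g : G) (x : X), f (X.ρ g x) = Y.ρ g (f x)) :
    continuousCohomology 1 X →+ continuousCohomology 1 Y :=
  liftH1AddHom X ((oneCocycleClassₗ Y).toAddMonoidHom.comp (contOneCocycles.pushAddHom f hf hρ))
    fun φ hφ ↦ by
    obtain ⟨v, hv⟩ := (oneCocycleClass_eq_zero_iff X φ).mp hφ
    change oneCocycleClass Y (contOneCocycles.pushAddHom f hf hρ φ) = 0
    rw [oneCocycleClass_eq_zero_iff]
    exact ⟨f v, fun g ↦ by rw [contOneCocycles.pushAddHom_apply, hv g, map_sub, hρ]⟩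

/-- `mapH1AddHom f [φ] = [f ∘ φ]` (functoriality of `H¹` in the coefficients on inhomogeneous
cochains). [cite: SerreGaloisCohomology1997, I §2.2] -/
@[simp]
theorem mapH1AddHom_oneCocycleClass (f : X →+ Y) (hf : Continuous f)
    (hρ : ∀ (g : G) (x : X), f (X.ρ g x) = Y.ρ g (f x)) (φ : contOneCocycles X) :
    mapH1AddHom X Y f hf hρ (oneCocycleClass X φ) =
      oneCocycleClass Y (contOneCocycles.pushAddHom f hf hρ φ) := by
  rw [mapH1AddHom, liftH1AddHom_oneCocycleClass]
  rfl

/-! ### Compatibility with restriction, corestriction and conjugation (subgroups of `G`) -/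

variable {H H' : Subgroup G}

/-- **`f_*` commutes with restriction**: for `H ≤ H'`, `f_* ∘ res_{H'→H} = res_{H'→H} ∘ f_*` on `H¹`
(both are `[φ] ↦ [f ∘ φ|_H]` on cocycles: the compatible pairs `(H ↪ H', f)` compose either way).
[cite: SerreGaloisCohomology1997, I §2.4] -/
theorem mapH1AddHom_resLe (f : X →+ Y) (hf : Continuous f) (h : H ≤ H')
    (hH : ∀ (g : H) (x : X), f ((subgroupRep X H).ρ g x) = (subgroupRep Y H).ρ g (f x))
    (hH' : ∀ (g : H') (x : X), f ((subgroupRep X H').ρ g x) = (subgroupRep Y H').ρ g (f x))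
    (c : continuousCohomology 1 (subgroupRep X H')) :
    mapH1AddHom (subgroupRep X H) (subgroupRep Y H) f hf hH (resLe X h 1 c) =
      resLe Y h 1 (mapH1AddHom (subgroupRep X H') (subgroupRep Y H') f hf hH' c) := by
  obtain ⟨φ, rfl⟩ := oneCocycleClass_surjective _ c
  rw [resLe_oneCocycleClass, mapH1AddHom_oneCocycleClass, mapH1AddHom_oneCocycleClass,
    resLe_oneCocycleClass]
  exact congrArg _ (Subtype.ext (ContinuousMap.ext fun g ↦ rfl))

/-- **`f_*` commutes with corestriction**: for `H ≤ H'` with `H` open of finite index in `H'`,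
`f_* ∘ cor_{H→H'} = cor_{H→H'} ∘ f_*` on `H¹` — on cocycles both are the transfer
`g ↦ Σ_x s(g·x) • f(φ(s(g·x)⁻¹ g s(x)))`, `f` being additive and equivariant
(`coresLe_oneCocycleClass`) — "Cor" is a morphism of cohomological functors.
[cite: SerreGaloisCohomology1997, I §2.4] [cite: NeukirchSchmidtWingberg2008, I §5] -/
theorem mapH1AddHom_coresLe (f : X →+ Y) (hf : Continuous f) (h : H ≤ H')
    (hHo : IsOpen (H : Set G)) [hF : Fintype (H' ⧸ H.subgroupOf H')]
    (hH : ∀ (g : H) (x : X), f ((subgroupRep X H).ρ g x) = (subgroupRep Y H).ρ g (f x))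
    (hH' : ∀ (g : H') (x : X), f ((subgroupRep X H').ρ g x) = (subgroupRep Y H').ρ g (f x))
    (c : continuousCohomology 1 (subgroupRep X H)) :
    mapH1AddHom (subgroupRep X H') (subgroupRep Y H') f hf hH' (coresLe X h hHo c) =
      coresLe Y h hHo (mapH1AddHom (subgroupRep X H) (subgroupRep Y H) f hf hH c) := by
  obtain ⟨φ, rfl⟩ := oneCocycleClass_surjective _ c
  rw [coresLe_oneCocycleClass X h hHo QuotientGroup.out_eq' φ, mapH1AddHom_oneCocycleClass,
    mapH1AddHom_oneCocycleClass, coresLe_oneCocycleClass Y h hHo QuotientGroup.out_eq']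
  refine congrArg _ (Subtype.ext (ContinuousMap.ext fun g ↦ ?_))
  rw [contOneCocycles.pushAddHom_apply, transferCocycle_apply, transferCocycle_apply, transferFun_apply,
    transferFun_apply, map_sum]
  refine Finset.sum_congr rfl fun x _ ↦ ?_
  rw [hH']
  rfl

/-- **`f_*` commutes with the conjugation action** of `g ∈ G` on `H¹(H, –)` for `H` normal:
`f_* (g · [φ]) = g · f_* [φ]` (on cocycles both are `x ↦ g • f(φ(g⁻¹ x g))`; the `G/H`-action on
`Hⁿ(H, –)` is functorial in the `G`-module). [cite: NeukirchSchmidtWingberg2008, I §5] -/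
theorem mapH1AddHom_conjMap (f : X →+ Y) (hf : Continuous f)
    (hρ : ∀ (g : G) (x : X), f (X.ρ g x) = Y.ρ g (f x)) [H.Normal] (g : G)
    (hH : ∀ (g : H) (x : X), f ((subgroupRep X H).ρ g x) = (subgroupRep Y H).ρ g (f x))
    (c : continuousCohomology 1 (subgroupRep X H)) :
    mapH1AddHom (subgroupRep X H) (subgroupRep Y H) f hf hH (conjMap X H g 1 c) =
      conjMap Y H g 1 (mapH1AddHom (subgroupRep X H) (subgroupRep Y H) f hf hH c) := by
  obtain ⟨φ, rfl⟩ := oneCocycleClass_surjective _ c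
  rw [conjMap_oneCocycleClass, mapH1AddHom_oneCocycleClass, mapH1AddHom_oneCocycleClass,
    conjMap_oneCocycleClass]
  refine congrArg _ (Subtype.ext (ContinuousMap.ext fun x ↦ ?_))
  rw [contOneCocycles.pushAddHom_apply, conj_pullback_apply, conj_pullback_apply, hρ]
  rfl

end AddHom

end Literature.NumberTheory.GaloisRepresentations

/-! ## §2 The reduction `T_pW → W[p]` and the levelwise reduction on `H¹` -/

namespace Literature.NumberTheory.EllipticCurves.Kato2004

section Reduction

variable (W : WeierstrassCurve ℚ) [W.IsElliptic] (p : ℕ) [Fact p.Prime]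

/-- **Reduction modulo `p` on the Tate module**: `T_pW → W[p]`, `a = (a_n)_n ↦ a_1` (the first
component `TateModule.proj p 1`, with values in `E(ℚ̄)[p] = geomTorsion W p`).  This is the map
`T → T/pT = T/p` of Kato §13.8 for `T = T_pW` (`T_pW/p ≅ W[p]`: `TateModule.proj_div`,
`proj_surjective_of_isAlgClosed`).  [cite: Kato2004Asterisque, §13.8 (p. 228)] -/
def tateModP : W.tateModule p →+ geomTorsion W (p : ℤ) where
  toFun a := ⟨TateModule.proj p 1 a, by simpa using W.proj_tateModule_mem_geomTorsion p 1 a⟩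
  map_zero' := Subtype.ext (map_zero _)
  map_add' a b := Subtype.ext (map_add _ a b)

omit [W.IsElliptic] [Fact p.Prime] in
/-- Unfolding `tateModP`: its value is the first component. [cite: Kato2004Asterisque, §13.8 (p. 228)] -/
@[simp]
theorem coe_tateModP_apply (a : W.tateModule p) :
    ((tateModP W p a : geomTorsion W (p : ℤ)) : geomPoints W) = TateModule.proj p 1 a :=
  rfl

omit [W.IsElliptic] [Fact p.Prime] in
/-- `tateModP` is continuous (the components of `T_pW` are continuous, `W[p]` is discrete).
[cite: Kato2004Asterisque, §13.8 (p. 228)] -/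
theorem continuous_tateModP : Continuous (tateModP W p) :=
  Continuous.subtype_mk (TateModule.continuous_proj (A := geomPoints W) (p := p) 1) _

omit [W.IsElliptic] [Fact p.Prime] in
/-- `tateModP` is `Γ_ℚ`-equivariant (the action on `T_pW` is componentwise).
[cite: Kato2004Asterisque, §13.8 (p. 228)] -/
theorem tateModP_smul (σ : absoluteGaloisGroup ℚ) (a : W.tateModule p) :
    tateModP W p (σ • a) = σ • tateModP W p a :=
  Subtype.ext (by
    rw [coe_tateModP_apply, TateModule.proj_smul_of_distribMulAction,
      AddSubgroup.torsionBy.coe_smul, coe_tateModP_apply])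

variable [ContinuousSMul ℤ_[p] (W.tateModule p)]

/-- Equivariance of `tateModP` for the restricted representations `T_pW|_U`, `W[p]|_U` of a subgroup
`U ≤ Γ_ℚ` (the hypothesis shape of `mapH1AddHom`). [cite: Kato2004Asterisque, §13.8 (p. 228)] -/
theorem tateModP_subgroupRep (U : Subgroup (absoluteGaloisGroup ℚ)) (u : U) (a : W.tateModule p) :
    tateModP W p ((subgroupRep (tateRep W p).toTopRep U).ρ u a) =
      (subgroupRep (W.torsionGaloisModule (p : ℤ)).toTopRep U).ρ u (tateModP W p a) :=
  tateModP_smul W p (u : absoluteGaloisGroup ℚ) a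

/-- Equivariance of `tateModP` for the full representations (the hypothesis shape of
`mapH1AddHom_conjMap`). [cite: Kato2004Asterisque, §13.8 (p. 228)] -/
theorem tateModP_toTopRep (σ : absoluteGaloisGroup ℚ) (a : W.tateModule p) :
    tateModP W p ((tateRep W p).toTopRep.ρ σ a) =
      (W.torsionGaloisModule (p : ℤ)).toTopRep.ρ σ (tateModP W p a) :=
  tateModP_smul W p σ a

/-- **The levelwise reduction `red_U : H¹(U, T_pW) → H¹(U, W[p])`** for a subgroup `U ≤ Γ_ℚ`
(`U = Gal(ℚ̄/F)`: `H¹(F, T_pW) → H¹(F, W[p])`), induced on continuous cochains by `T_pW → W[p]`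
(`mapH1AddHom` along `tateModP`; source over `ℤ_p`, target the discrete `ℤ`-module `W[p]` of
`W.torsionGaloisModule p`).  This is the change of coefficients `T → T/p` of Kato §13.8 at a finite
level.  [cite: Kato2004Asterisque, §13.8 (pp. 228–229)] -/
def reduceH1 (U : Subgroup (absoluteGaloisGroup ℚ)) :
    H1 (tateRep W p) U →+ H1 (W.torsionGaloisModule (p : ℤ)) U :=
  mapH1AddHom (subgroupRep (tateRep W p).toTopRep U)
    (subgroupRep (W.torsionGaloisModule (p : ℤ)).toTopRep U) (tateModP W p)
    (continuous_tateModP W p) (tateModP_subgroupRep W p U)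

/-- `reduceH1` on explicit cocycles: `red [φ] = [φ mod p]`. [cite: Kato2004Asterisque, §13.8 (p. 228)] -/
theorem reduceH1_oneCocycleClass (U : Subgroup (absoluteGaloisGroup ℚ))
    (φ : contOneCocycles (subgroupRep (tateRep W p).toTopRep U)) :
    reduceH1 W p U (oneCocycleClass _ φ) =
      oneCocycleClass _ (contOneCocycles.pushAddHom (tateModP W p) (continuous_tateModP W p)
        (tateModP_subgroupRep W p U) φ) :=
  mapH1AddHom_oneCocycleClass _ _ _ φ

/-- `red` commutes with restriction `H¹(U', ·) → H¹(U, ·)`, `U ≤ U'`.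
[cite: Kato2004Asterisque, §13.8 (p. 228)] -/
theorem reduceH1_resLe {U U' : Subgroup (absoluteGaloisGroup ℚ)} (h : U ≤ U')
    (c : H1 (tateRep W p) U') :
    reduceH1 W p U (resLe (tateRep W p).toTopRep h 1 c) =
      resLe (W.torsionGaloisModule (p : ℤ)).toTopRep h 1 (reduceH1 W p U' c) :=
  mapH1AddHom_resLe _ _ h _ _ c

/-- `red` commutes with the relative corestriction `Cor : H¹(U, ·) → H¹(U', ·)`, `U ≤ U'` open of
finite index (e.g. the trace maps between Kato's levels `ℚ(ζ_m)`, `Kato2004.coresToLayer`).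
[cite: Kato2004Asterisque, §13.8 (p. 228)] -/
theorem reduceH1_coresLe {U U' : Subgroup (absoluteGaloisGroup ℚ)} (h : U ≤ U')
    (hU : IsOpen (U : Set (absoluteGaloisGroup ℚ))) [hF : Fintype (U' ⧸ U.subgroupOf U')]
    (c : H1 (tateRep W p) U) :
    reduceH1 W p U' (coresLe (tateRep W p).toTopRep h hU c) =
      coresLe (W.torsionGaloisModule (p : ℤ)).toTopRep h hU (reduceH1 W p U c) :=
  mapH1AddHom_coresLe (hF := hF) _ _ h hU _ _ c

/-- `red` commutes with the trace maps `Cor : H¹(ℚ_{n+1}, ·) → H¹(ℚ_n, ·)` of a `ℤ_p`-extension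
(`Kato2004.layerCores`). [cite: Kato2004Asterisque, §12.2 (p. 220) and §13.8 (p. 228)] -/
theorem reduceH1_layerCores (κ : ZpExtension ℚ p) (n : ℕ)
    (c : H1 (tateRep W p) (κ.layerSubgroup (n + 1))) :
    reduceH1 W p (κ.layerSubgroup n) (layerCores (tateRep W p) κ n c) =
      layerCores (W.torsionGaloisModule (p : ℤ)) κ n (reduceH1 W p (κ.layerSubgroup (n + 1)) c) := by
  unfold layerCores
  exact reduceH1_coresLe W p (hF := _) _ _ c

/-- `red` commutes with the action of `σ ∈ Γ_ℚ` on `H¹(U, ·)` for `U` normal (`conjMap`; e.g.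
`conj_γ` on the layers of a `ℤ_p`-extension, through which `T ∈ Λ` acts as `conj_γ − 1`).
[cite: Kato2004Asterisque, §13.8 (p. 228)] -/
theorem reduceH1_conjMap (U : Subgroup (absoluteGaloisGroup ℚ)) [U.Normal]
    (σ : absoluteGaloisGroup ℚ) (c : H1 (tateRep W p) U) :
    reduceH1 W p U (conjMap (tateRep W p).toTopRep U σ 1 c) =
      conjMap (W.torsionGaloisModule (p : ℤ)).toTopRep U σ 1 (reduceH1 W p U c) :=
  mapH1AddHom_conjMap _ _ (tateModP_toTopRep W p) σ _ c

/-- **Integral classes reduce to integral classes**: `red (H¹(O_F[1/p], T_pW)) ⊆ H¹(O_F[1/p], W[p])`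
(`integralH1` = classes vanishing on every inertia group away from `p`; `red` commutes with the
restrictions to `U ⊓ I_𝔓`). [cite: Kato2004Asterisque, §8.2 and Lemma 8.5 (pp. 180–184)] -/
theorem reduceH1_mem_integralH1 (U : Subgroup (absoluteGaloisGroup ℚ)) {c : H1 (tateRep W p) U}
    (hc : c ∈ integralH1 (tateRep W p) p U) :
    reduceH1 W p U c ∈ integralH1 (W.torsionGaloisModule (p : ℤ)) p U := by
  rw [mem_integralH1_iff] at hc ⊢
  intro v hv 𝔓 h𝔓
  rw [← reduceH1_resLe, hc v hv 𝔓 h𝔓, map_zero]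

/-- `red` kills `p`-multiples: `red (p • c) = 0` (the coefficients `W[p]` are killed by `p`).
[cite: Kato2004Asterisque, §13.8 (p. 228)] -/
theorem reduceH1_natCast_smul (U : Subgroup (absoluteGaloisGroup ℚ)) (c : H1 (tateRep W p) U) :
    reduceH1 W p U ((p : ℤ_[p]) • c) = 0 := by
  obtain ⟨φ, rfl⟩ := oneCocycleClass_surjective _ c
  rw [← oneCocycleClass_smul, reduceH1_oneCocycleClass, oneCocycleClass_eq_zero_iff]
  refine ⟨0, fun g ↦ ?_⟩
  rw [map_zero, sub_zero, contOneCocycles.pushAddHom_apply]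
  apply Subtype.ext
  rw [coe_tateModP_apply]
  change TateModule.proj p 1 (((p : ℤ_[p]) • φ).1 g) = 0
  rw [Submodule.coe_smul, ContinuousMap.smul_apply, Nat.cast_smul_eq_nsmul, map_nsmul]
  have h1 := TateModule.proj_mem_torsionBy 1 (φ.1 g)
  rw [pow_one] at h1
  simpa using h1

end Reduction

/-! ## §3 (S0.4) The reduction on the pinned datum `𝐇¹_Γ(T_pW)` -/

namespace IwasawaH1Data

variable {W : WeierstrassCurve ℚ} [W.IsElliptic] {p : ℕ} [Fact p.Prime]
  [ContinuousSMul ℤ_[p] (W.tateModule p)] {κ : ZpExtension ℚ p} {γ : absoluteGaloisGroup ℚ}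
  (I : IwasawaH1Data W p κ γ)

/-- **The reduction `red : 𝐇¹_Γ(T_pW) → lim←_n H¹(ℚ_n, W[p])`** on the pinned datum, written
levelwise inside `∏_n H¹(ℚ_n, W[p])`: `x ↦ (red_n (proj n x))_n`.  Its values are norm-compatible
integral families (`red_mem_normCompatible`), i.e. `red` lands in `Kato2004.normCompatible
(W.torsionGaloisModule p) κ = lim←_n H¹(ℤ_n[1/p], W[p])` — the `Ω = Λ/p`-side Iwasawa cohomology
written along the layers; `T` acts compatibly as `conj_γ − 1` (`red_X_smul`).  This is Kato's
`𝐇¹(T) → 𝐇¹(T)/p𝐇¹(T) ⊂ H¹(ℤ[1/p], T ⊗ Λ/pΛ) = lim←_n H¹(ℤ[ζ_{p^n}, 1/p], T/p)` (§13.8, module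
docstring (r1)–(r4)) for `T = T_pW` on the `Δ`-trivial component.
[cite: Kato2004Asterisque, §13.8 (pp. 228–229) with §12.2 (p. 220)] -/
def red : I.H →+ ∀ n : ℕ, H1 (W.torsionGaloisModule (p : ℤ)) (κ.layerSubgroup n) where
  toFun x n := reduceH1 W p (κ.layerSubgroup n) (I.proj n x)
  map_zero' := funext fun n ↦ by rw [map_zero, map_zero]; rfl
  map_add' x y := funext fun n ↦ by rw [map_add, map_add]; rfl

/-- Unfolding `red`: its `n`-th component is `red_n (proj n x)`.
[cite: Kato2004Asterisque, §13.8 (p. 228)] -/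
@[simp]
theorem red_apply (x : I.H) (n : ℕ) : I.red x n = reduceH1 W p (κ.layerSubgroup n) (I.proj n x) :=
  rfl

/-- The reduction of an element of `𝐇¹_Γ(T_pW)` is a norm-compatible integral family of
`∏_n H¹(ℚ_n, W[p])` (`proj_mem`, `cores_proj` of the pin and `reduceH1_mem_integralH1`,
`reduceH1_layerCores`). [cite: Kato2004Asterisque, §12.2 (p. 220) and §13.8 (p. 228)] -/
theorem isNormCompatible_red (x : I.H) :
    IsNormCompatible (W.torsionGaloisModule (p : ℤ)) κ (I.red x) := by
  refine ⟨fun n ↦ ?_, fun n ↦ ?_⟩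
  · rw [red_apply]
    exact reduceH1_mem_integralH1 W p _ (I.proj_mem n x)
  · rw [red_apply, red_apply, ← reduceH1_layerCores, I.cores_proj n x]

/-- `red x ∈ normCompatible (W.torsionGaloisModule p) κ = lim←_n H¹(ℤ_n[1/p], W[p])`.
[cite: Kato2004Asterisque, §12.2 (p. 220) and §13.8 (p. 228)] -/
theorem red_mem_normCompatible (x : I.H) :
    I.red x ∈ normCompatible (W.torsionGaloisModule (p : ℤ)) κ :=
  I.isNormCompatible_red x

/-- **`red` is `Λ → Ω`-semilinear for `T`**: `red (T • x) = (conj_γ − 1) (red x)` levelwise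
(`proj_T_smul` of the pin and `reduceH1_conjMap`). [cite: Kato2004Asterisque, §13.8 (p. 228)] -/
theorem red_X_smul (x : I.H) (n : ℕ) :
    I.red ((PowerSeries.X : IwasawaAlgebra p) • x) n =
      conjMap (W.torsionGaloisModule (p : ℤ)).toTopRep (κ.layerSubgroup n) γ 1 (I.red x n) -
        I.red x n := by
  rw [red_apply, I.proj_T_smul n x, map_sub, reduceH1_conjMap, red_apply]

/-- Constants of `Λ` reduce through `ℤ_p → 𝔽_p`: in particular `red (p • x) = 0`
(`proj_C_smul` and `reduceH1_natCast_smul`). [cite: Kato2004Asterisque, §13.8 (p. 228)] -/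
theorem red_C_natCast_smul (x : I.H) :
    I.red (PowerSeries.C (p : ℤ_[p]) • x) = 0 := by
  funext n
  rw [red_apply, I.proj_C_smul, reduceH1_natCast_smul]
  rfl

/-- **`p·𝐇¹ ⊆ ker red`** (the trivial inclusion of S0.5): every element of `(p) • 𝐇¹_Γ(T_pW)`
(`IwasawaAlgebra.augIdealP p = (p) ⊂ Λ`) has zero reduction. [cite: Kato2004Asterisque, §13.8 (p. 228)] -/
theorem red_eq_zero_of_mem {x : I.H}
    (hx : x ∈ (IwasawaAlgebra.augIdealP p) • (⊤ : Submodule (IwasawaAlgebra p) I.H)) :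
    I.red x = 0 := by
  rw [IwasawaAlgebra.augIdealP, Submodule.ideal_span_singleton_smul,
    Submodule.mem_smul_pointwise_iff_exists] at hx
  obtain ⟨y, -, rfl⟩ := hx
  exact I.red_C_natCast_smul y

end IwasawaH1Data

/-! ## §4 (S0.5) Kato §13.8: `𝐇¹(T)/p𝐇¹(T) ⊂ 𝐇¹(T/p)` on the pin — the named fact and its consumer
shapes -/

/-- **Kato 2004, §13.8 (proof of Thm. 12.4 (2)(3), pp. 228–229) for `T = T_pW`, `x = p`, read on the
pinned datum `𝐇¹_Γ(T_pW)`: the kernel of the reduction modulo `p` is `p·𝐇¹`.**  Printed: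
"`𝐇¹(T)/x𝐇¹(T) ⊂ H¹(ℤ[1/p], T ⊗_{O_λ} Λ/xΛ)`" [p. 229] for a non-zero-divisor `x ∈ Λ` (from the exact
sequence of `0 → T ⊗ Λ →x T ⊗ Λ → T ⊗ Λ/xΛ → 0` and "`𝐇^q(T) = lim←_n H^q(ℤ[1/p], T ⊗_{O_λ} O_λ[G_n])`"
[p. 228]), together with "`H^q(ℤ[ζ_{p^n}, 1/p], T) ≅ H^q(ℤ[1/p], T ⊗_{O_λ} O_λ[G_n])`" [p. 228] for the
module `T/p` and Lemma 8.5 (1) [p. 183] (`H¹(O_K[1/p], ·) ↪ H¹(K, ·)`), which identify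
`H¹(ℤ[1/p], T ⊗ Λ/pΛ)` with `lim←_n H¹(ℤ[ζ_{p^n}, 1/p], T/p) ⊆ ∏_n H¹(ℚ(ζ_{p^n}), T/p)` compatibly with
the change of coefficients `T → T/p` (module docstring, READING (r1)–(r4)).  ON THE PIN (`Δ`-trivial
component along the layers `ℚ_n` of the cyclotomic `κ`, the reading of `nonempty_iwasawaH1Data` /
`thm12_4`): for every elliptic curve `W/ℚ`, prime `p`, cyclotomic `κ` with topological generator `γ`,
datum `I : IwasawaH1Data W p κ γ` and `x ∈ I.H` — if every levelwise reduction
`red_n (proj n x) ∈ H¹(ℚ_n, W[p])` vanishes (`I.red x = 0`), then `x ∈ p·I.H = (augIdealP p) • ⊤`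
(`IwasawaAlgebra.augIdealP p = (p) ⊂ Λ`).  The converse inclusion is PROVED (`red_eq_zero_of_mem`).
Consumed by the cell's `stub_coreX9` (crux 19276, Step 0 of MU-TRANSFER-PROOF): `s ∉ p𝐇¹ ⟹ red s ≠ 0`
(`mem_pSmul_of_red_eq_zero.exists_red_ne_zero`).  Named fact; nothing asserted; a `_holds` would go
through the continuous-cochain exact sequence of `0 → T_pW →p T_pW → W[p] → 0` levelwise, a
compactness (Mittag-Leffler) choice of compatible `p`-th roots, and Lemma 8.5 (2) for their integrality.
-- TODO(general form): Kato's `𝐇¹(T)/x𝐇¹(T) ⊂ H¹(ℤ[1/p], T ⊗ Λ/xΛ)` for every non-zero-divisor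
-- `x ∈ Λ = O_λ[[G_∞]]`, all `Δ`-components, newforms of weight `k ≥ 2` and arbitrary lattices `T`.
[cite: Kato2004Asterisque, §13.8 (pp. 228–229) with §12.2 (p. 220) and Lemma 8.5 (1) (p. 183)] -/
def mem_pSmul_of_red_eq_zero : Prop :=
  ∀ (W : WeierstrassCurve ℚ) [W.IsElliptic] (p : ℕ) [Fact p.Prime]
    [ContinuousSMul ℤ_[p] (W.tateModule p)] (κ : ZpExtension ℚ p) (γ : absoluteGaloisGroup ℚ),
    κ.IsCyclotomic → κ.IsTopGenerator γ → ∀ (I : IwasawaH1Data W p κ γ) (x : I.H),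
      I.red x = 0 → x ∈ (IwasawaAlgebra.augIdealP p) • (⊤ : Submodule (IwasawaAlgebra p) I.H)

namespace mem_pSmul_of_red_eq_zero

variable {W : WeierstrassCurve ℚ} [W.IsElliptic] {p : ℕ} [Fact p.Prime]
  [ContinuousSMul ℤ_[p] (W.tateModule p)] {κ : ZpExtension ℚ p} {γ : absoluteGaloisGroup ℚ}

/-- Consumer shape: under the fact, **`ker red = p·𝐇¹`** — `I.red x = 0 ↔ x ∈ (p) • 𝐇¹_Γ(T_pW)`
(the backward implication is the proved `red_eq_zero_of_mem`).
[cite: Kato2004Asterisque, §13.8 (pp. 228–229)] -/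
theorem red_eq_zero_iff (h : mem_pSmul_of_red_eq_zero) (hκ : κ.IsCyclotomic)
    (hγ : κ.IsTopGenerator γ) (I : IwasawaH1Data W p κ γ) (x : I.H) :
    I.red x = 0 ↔ x ∈ (IwasawaAlgebra.augIdealP p) • (⊤ : Submodule (IwasawaAlgebra p) I.H) :=
  ⟨h W p κ γ hκ hγ I x, fun hx ↦ I.red_eq_zero_of_mem hx⟩

/-- Consumer shape (the form used by `stub_coreX9`, crux 19276): under the fact, an element of
`𝐇¹_Γ(T_pW)` outside `p𝐇¹` — e.g. Kato's `Λ`-adic zeta element `s` with `s ∉ (augIdealP p) • ⊤` — has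
a NON-ZERO reduction at some layer: `∃ n, red_n (proj n s) ≠ 0` in `H¹(ℚ_n, W[p])`.
[cite: Kato2004Asterisque, §13.8 (pp. 228–229)] -/
theorem exists_red_ne_zero (h : mem_pSmul_of_red_eq_zero) (hκ : κ.IsCyclotomic)
    (hγ : κ.IsTopGenerator γ) (I : IwasawaH1Data W p κ γ) {s : I.H}
    (hs : s ∉ (IwasawaAlgebra.augIdealP p) • (⊤ : Submodule (IwasawaAlgebra p) I.H)) :
    ∃ n : ℕ, reduceH1 W p (κ.layerSubgroup n) (I.proj n s) ≠ 0 := by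
  by_contra hne
  push Not at hne
  exact hs (h W p κ γ hκ hγ I s (funext fun n ↦ hne n))

/-- Consumer shape: under the fact, the norm-compatible family `red s ∈ lim←_n H¹(ℤ_n[1/p], W[p])`
of an element `s ∉ p𝐇¹` is non-zero. [cite: Kato2004Asterisque, §13.8 (pp. 228–229)] -/
theorem red_ne_zero (h : mem_pSmul_of_red_eq_zero) (hκ : κ.IsCyclotomic)
    (hγ : κ.IsTopGenerator γ) (I : IwasawaH1Data W p κ γ) {s : I.H}
    (hs : s ∉ (IwasawaAlgebra.augIdealP p) • (⊤ : Submodule (IwasawaAlgebra p) I.H)) :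
    I.red s ≠ 0 :=
  fun h0 ↦ hs (h W p κ γ hκ hγ I s h0)

end mem_pSmul_of_red_eq_zero

end Literature.NumberTheory.EllipticCurves.Kato2004

end
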